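import Mathlib
import Summits.MatrixMultiplication.MatrixMultiplication.Theorems.SnSubsetDichotomyPolynomialSlackAtomData
import Summits.MatrixMultiplication.MatrixMultiplication.Theorems.SnSubsetDichotomyPolynomialSlackHubMassValue
import Summits.MatrixMultiplication.MatrixMultiplication.Theorems.SnSubsetDichotomyPolynomialSlackBlockCounts
import Summits.MatrixMultiplication.MatrixMultiplication.Theorems.SnSubsetDichotomyPolynomialSlackDyadicLevels

/-!
# Atom basic facts: the win-free bookkeeping of the atoms at one position

Crux `Summit.MatrixMultiplication.MatrixMultiplication.Theses.SnSubsetDichotomy.PolynomialSlack`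
(item `stmt-MatrixMultiplication-8306`), line transport-split-hull (lead c9), programme B
"atoms endgame", stub `atom_basic_facts` (HA0).

At a fixed position `k`, the heavy entries of the quotient densities `dB(·,k)` (threshold
`θB ≥ 16/n`) are split into dyadic LEVEL BLOCKS `J_{k,a} = {j : θB ≤ dB j k, ⌊log₂(1/dB j k)⌋₊ = a}`,
likewise `dC(k,·)` into blocks `I_{k,b}`; `σ a / σ' a` are the `pB / dB` masses of block `a`,
`ρ b / ρ' b` likewise, `h a b = Σ_v μ_v X_a(v) Y_b(v)` is the hub mass of the atom `(a,b)` and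
`Ψ a b` its kept level-one mass. `atom_basic_facts` collects the ten win-free bookkeeping facts
consumed by the per-position lemma `position_kept_bound`:

* kept masses are comparable to block masses (`0 ≤ σ ≤ σ' ≤ (16/15) σ`, same for `ρ`);
* hub masses are nonnegative, their row/column sums are bounded by the block masses, and they
  obey the budget inequality `Σ_P σ' + Σ_Q ρ' ≤ 1 + Σ_{P×Q} h` of two sub-partitions of unity;
* `Ψ ≥ 0`, and the kept sums `Σ_j pB`, `Σ_i pC`, `Σ_i Σ_j dA pB pC` split over the levels/atoms.

The helpers are stated for curried profiles `d : Fin n → ℝ` (i.e. `j ↦ dB j k`, `i ↦ dC k i`).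
-/

namespace Summit.MatrixMultiplication.MatrixMultiplication.Theorems.PolynomialSlack

set_option linter.dupNamespace false

open scoped BigOperators

/-! ## Kept entries on heavy cells -/

/-- On a heavy cell (`16/n ≤ θ ≤ x`) the kept entry `x - 1/n` satisfies `0 ≤ x - 1/n` and
`15/16 · x ≤ x - 1/n`. [folklore] -/
theorem heavy_kept_bounds {n : ℕ} (hn : 0 < n) (θ x : ℝ) (hθ : 16 / (n : ℝ) ≤ θ) (hx : θ ≤ x) :
    0 ≤ x - 1 / n ∧ 15 / 16 * x ≤ x - 1 / n := by
  have hn' : (0 : ℝ) < n := by exact_mod_cast hn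
  have h0 : (0 : ℝ) ≤ 1 / n := by positivity
  have h16 : 16 * (1 / (n : ℝ)) ≤ x := by
    rw [← div_eq_mul_one_div]
    exact hθ.trans hx
  constructor <;> linarith

/-- The kept entry `p = (x - 1/n)·1[θ ≤ x]` is nonnegative when `16/n ≤ θ`. [folklore] -/
theorem kept_nonneg {n : ℕ} (hn : 0 < n) (θ x p : ℝ) (hθ : 16 / (n : ℝ) ≤ θ)
    (hp : p = if θ ≤ x then x - 1 / n else 0) : 0 ≤ p := by
  rw [hp]
  split_ifs with hx
  · exact (heavy_kept_bounds hn θ x hθ hx).1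
  · exact le_refl 0

/-- **Kept block masses versus block masses.** On a level block of the heavy column
(`16/n ≤ θ ≤ d j` there) the kept mass `Σ p = Σ (d - 1/n)` satisfies
`0 ≤ Σ p ≤ Σ d` and `15/16 · Σ d ≤ Σ p`. [folklore] -/
theorem level_sums_cmp {n : ℕ} (hn : 0 < n) (d p : Fin n → ℝ) (θ : ℝ) (hθ : 16 / (n : ℝ) ≤ θ)
    (hp : ∀ j, p j = if θ ≤ d j then d j - 1 / n else 0) (a : ℕ) :
    0 ≤ ∑ j ∈ Finset.univ.filter (fun j => θ ≤ d j ∧ ⌊Real.logb 2 (1 / d j)⌋₊ = a), p j ∧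
    ∑ j ∈ Finset.univ.filter (fun j => θ ≤ d j ∧ ⌊Real.logb 2 (1 / d j)⌋₊ = a), p j ≤
      ∑ j ∈ Finset.univ.filter (fun j => θ ≤ d j ∧ ⌊Real.logb 2 (1 / d j)⌋₊ = a), d j ∧
    15 / 16 * ∑ j ∈ Finset.univ.filter (fun j => θ ≤ d j ∧ ⌊Real.logb 2 (1 / d j)⌋₊ = a), d j ≤
      ∑ j ∈ Finset.univ.filter (fun j => θ ≤ d j ∧ ⌊Real.logb 2 (1 / d j)⌋₊ = a), p j := by
  have hmem : ∀ j ∈ Finset.univ.filter (fun j => θ ≤ d j ∧ ⌊Real.logb 2 (1 / d j)⌋₊ = a),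
      p j = d j - 1 / n ∧ 0 ≤ d j - 1 / n ∧ 15 / 16 * d j ≤ d j - 1 / n := by
    intro j hj
    simp only [Finset.mem_filter, Finset.mem_univ, true_and] at hj
    exact ⟨by rw [hp, if_pos hj.1], heavy_kept_bounds hn θ (d j) hθ hj.1⟩
  have h0 : (0 : ℝ) ≤ 1 / n := by positivity
  refine ⟨Finset.sum_nonneg fun j hj => ?_, Finset.sum_le_sum fun j hj => ?_, ?_⟩
  · obtain ⟨e, h1, -⟩ := hmem j hj
    rw [e]
    exact h1
  · obtain ⟨e, -, -⟩ := hmem j hj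
    rw [e]
    linarith
  · rw [Finset.mul_sum]
    refine Finset.sum_le_sum fun j hj => ?_
    obtain ⟨e, -, h2⟩ := hmem j hj
    rw [e]
    exact h2

/-! ## Heavy sums split over the levels -/

/-- `16/n ≤ θ` and `1 ≤ n` give `1/n² ≤ θ` (as `1/n² ≤ 1/n ≤ 16/n`). [folklore] -/
theorem inv_sq_le_theta {n : ℕ} (hn : 1 ≤ n) (θ : ℝ) (hθ : 16 / (n : ℝ) ≤ θ) :
    1 / (n : ℝ) ^ 2 ≤ θ := by
  have hn' : (1 : ℝ) ≤ n := by exact_mod_cast hn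
  refine le_trans ?_ hθ
  rw [div_le_div_iff₀ (by positivity) (by positivity)]
  nlinarith

/-- A pair density `#{(x,y) ∈ X × Y : P}/(|X|·|Y|)` is at most `1`. [folklore] -/
theorem pairDensity_le_one {n : ℕ} (X Y : Finset (Equiv.Perm (Fin n)))
    (P : Equiv.Perm (Fin n) × Equiv.Perm (Fin n) → Prop) [DecidablePred P] :
    (((X ×ˢ Y).filter P).card : ℝ) / (X.card * Y.card : ℕ) ≤ 1 := by
  refine div_le_one_of_le₀ ?_ (Nat.cast_nonneg _)
  rw [← Finset.card_product]
  exact_mod_cast Finset.card_filter_le _ _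

/-- **Sums of kept quantities split over the levels.** If `16/n ≤ θ`, `d ≤ 1` and `g` vanishes
off the heavy cells `{j : θ ≤ d j}`, then `Σ_j g j = Σ_a Σ_{j ∈ J_a} g j` over the
`⌊log₂ n²⌋₊ + 1` level blocks `J_a` of the heavy column (`sum_heavy_eq_sum_levels`). [folklore] -/
theorem sum_eq_sum_levels_of_vanish {n : ℕ} (hn : 1 ≤ n) (d : Fin n → ℝ) (θ : ℝ)
    (hθ : 16 / (n : ℝ) ≤ θ) (hd1 : ∀ j, d j ≤ 1) (g : Fin n → ℝ)
    (hg : ∀ j, ¬θ ≤ d j → g j = 0) :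
    ∑ j, g j = ∑ a : Fin (⌊Real.logb 2 ((n : ℝ) ^ 2)⌋₊ + 1),
      ∑ j ∈ Finset.univ.filter (fun j => θ ≤ d j ∧ ⌊Real.logb 2 (1 / d j)⌋₊ = a.val), g j := by
  rw [← sum_heavy_eq_sum_levels hn d θ (inv_sq_le_theta hn θ hθ) hd1 g, Finset.sum_filter]
  refine Finset.sum_congr rfl fun j _ => ?_
  by_cases hj : θ ≤ d j
  · rw [if_pos hj]
  · rw [if_neg hj, hg j hj]

/-- **Double kept sums split over the atoms.** If `F i j` vanishes unless both `θC ≤ dC i` and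
`θB ≤ dB j`, then `Σ_i Σ_j F i j = Σ_a Σ_b Σ_{i ∈ I_b} Σ_{j ∈ J_a} F i j` over the level
blocks `I_b` of `dC` and `J_a` of `dB`. [folklore] -/
theorem double_sum_eq_sum_atoms {n : ℕ} (hn : 1 ≤ n) (dB dC : Fin n → ℝ) (θB θC : ℝ)
    (hθB : 16 / (n : ℝ) ≤ θB) (hθC : 16 / (n : ℝ) ≤ θC) (hdB1 : ∀ j, dB j ≤ 1)
    (hdC1 : ∀ i, dC i ≤ 1) (F : Fin n → Fin n → ℝ) (hFB : ∀ i j, ¬θB ≤ dB j → F i j = 0)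
    (hFC : ∀ i j, ¬θC ≤ dC i → F i j = 0) :
    ∑ i, ∑ j, F i j = ∑ a : Fin (⌊Real.logb 2 ((n : ℝ) ^ 2)⌋₊ + 1),
      ∑ b : Fin (⌊Real.logb 2 ((n : ℝ) ^ 2)⌋₊ + 1),
        ∑ i ∈ Finset.univ.filter (fun i => θC ≤ dC i ∧ ⌊Real.logb 2 (1 / dC i)⌋₊ = b.val),
          ∑ j ∈ Finset.univ.filter (fun j => θB ≤ dB j ∧ ⌊Real.logb 2 (1 / dB j)⌋₊ = a.val),
            F i j := by
  -- split the outer sum over the levels of `dC` (the inner sums vanish off the heavy cells)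
  rw [sum_eq_sum_levels_of_vanish hn dC θC hθC hdC1 (fun i => ∑ j, F i j) fun i hi =>
    Finset.sum_eq_zero fun j _ => hFC i j hi]
  -- split the inner sums over the levels of `dB`
  have e1 : ∀ i, ∑ j, F i j = ∑ a : Fin (⌊Real.logb 2 ((n : ℝ) ^ 2)⌋₊ + 1),
      ∑ j ∈ Finset.univ.filter (fun j => θB ≤ dB j ∧ ⌊Real.logb 2 (1 / dB j)⌋₊ = a.val),
        F i j :=
    fun i => sum_eq_sum_levels_of_vanish hn dB θB hθB hdB1 (F i) (hFB i)
  simp only [e1]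
  -- exchange the order of summation
  exact (Finset.sum_congr rfl fun b _ => Finset.sum_comm).trans Finset.sum_comm

/-! ## The probability vector `μ` and the row block masses -/

/-- The fibres of `u ↦ u k` partition `U`: `Σ_v #{u ∈ U : u k = v}/|U| = 1` for `U` nonempty.
[folklore] -/
theorem sum_fibre_prob_eq_one {n : ℕ} (U : Finset (Equiv.Perm (Fin n))) (hU : U.Nonempty)
    (k : Fin n) : ∑ v : Fin n, ((U.filter fun u => u k = v).card : ℝ) / U.card = 1 := by
  have hUc : (U.card : ℝ) ≠ 0 := by exact_mod_cast hU.card_pos.ne'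
  rw [← Finset.sum_div, div_eq_one_iff_eq hUc, ← Nat.cast_sum, Nat.cast_inj]
  exact (Finset.card_eq_sum_card_fiberwise (f := fun u : Equiv.Perm (Fin n) => u k) (s := U)
    (t := Finset.univ) fun _ _ => Finset.mem_univ _).symm

/-- **Row block masses are `μ`-averages of pull-back probabilities.** For `U, S ⊆ S_n`, a block
`I` and a position `k`:
`Σ_{i ∈ I} #{(u,s) : s i = u k}/(|U|·|S|) = Σ_v (#{u : u k = v}/|U|) · (#{s : s⁻¹ v ∈ I}/|S|)`,
the normalised form of the hub row mass identity `sum_pairMarginal_row_block_eq`. [folklore] -/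
theorem blockMassRow_eq_sum_mu {n : ℕ} (U S : Finset (Equiv.Perm (Fin n))) (I : Finset (Fin n))
    (k : Fin n) :
    ∑ i ∈ I, (((U ×ˢ S).filter fun us => us.2 i = us.1 k).card : ℝ) / (U.card * S.card : ℕ) =
      ∑ v : Fin n, ((U.filter fun u => u k = v).card : ℝ) / U.card *
        (((S.filter fun s => s⁻¹ v ∈ I).card : ℝ) / S.card) := by
  rw [← Finset.sum_div, ← Nat.cast_sum, sum_pairMarginal_row_block_eq U S I k, Nat.cast_sum,
    Finset.sum_div]
  refine Finset.sum_congr rfl fun v _ => ?_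
  rw [div_mul_div_comm, Nat.cast_mul, Nat.cast_mul]

/-! ## Hub masses: positivity, row/column sums and the budget -/

/-- **Abstract hub-mass bookkeeping.** For a probability vector `μ`, nonnegative sub-partitions of
unity `X a, Y b`, block masses `σ' a = Σ μ X_a`, `ρ' b = Σ μ Y_b` and hub masses
`h a b = Σ μ X_a Y_b`: `h ≥ 0`, `Σ_b h a b ≤ σ' a`, `Σ_a h a b ≤ ρ' b`, and
`Σ_P σ' + Σ_Q ρ' ≤ 1 + Σ_P Σ_Q h`. [folklore] -/
theorem hub_budget_core {n m : ℕ} (μ : Fin n → ℝ) (X Y : Fin m → Fin n → ℝ) (σ' ρ' : Fin m → ℝ)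
    (h : Fin m → Fin m → ℝ) (hμ0 : ∀ v, 0 ≤ μ v) (hμ1 : ∑ v, μ v = 1) (hX0 : ∀ a v, 0 ≤ X a v)
    (hY0 : ∀ b v, 0 ≤ Y b v) (hX1 : ∀ (P : Finset (Fin m)) v, ∑ a ∈ P, X a v ≤ 1)
    (hY1 : ∀ (Q : Finset (Fin m)) v, ∑ b ∈ Q, Y b v ≤ 1) (hσ' : ∀ a, σ' a = ∑ v, μ v * X a v)
    (hρ' : ∀ b, ρ' b = ∑ v, μ v * Y b v) (hh : ∀ a b, h a b = ∑ v, μ v * (X a v * Y b v)) :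
    (∀ a b, 0 ≤ h a b) ∧ (∀ a, ∑ b, h a b ≤ σ' a) ∧ (∀ b, ∑ a, h a b ≤ ρ' b) ∧
      ∀ P Q : Finset (Fin m), ∑ a ∈ P, σ' a + ∑ b ∈ Q, ρ' b ≤ 1 + ∑ a ∈ P, ∑ b ∈ Q, h a b := by
  refine ⟨fun a b => ?_, fun a => ?_, fun b => ?_, fun P Q => ?_⟩
  · rw [hh]
    exact Finset.sum_nonneg fun v _ => mul_nonneg (hμ0 v) (mul_nonneg (hX0 a v) (hY0 b v))
  · rw [hσ']
    simp only [hh]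
    exact hubMass_rowSum_le μ X Y hμ0 hX0 hY0 hY1 a
  · calc ∑ a, h a b = ∑ a, ∑ v, μ v * (Y b v * X a v) := by
          refine Finset.sum_congr rfl fun a _ => ?_
          rw [hh]
          exact Finset.sum_congr rfl fun v _ => by ring
      _ ≤ ∑ v, μ v * Y b v := hubMass_rowSum_le μ Y X hμ0 hY0 hX0 hX1 b
      _ = ρ' b := (hρ' b).symm
  · simp only [hσ', hρ', hh]
    exact budget_of_subpartitions μ X Y hμ0 hμ1 hX0 hY0 hX1 hY1 P Q

/-- **Concrete hub-mass bookkeeping.** For nonempty `S, T, U ⊆ S_n`, a position `k`, pairwise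
disjoint blocks `J a` (columns) and `I b` (rows), the block masses
`σ' a = Σ_{j ∈ J a} m_{TU}(j,k)/(|T||U|)`, `ρ' b = Σ_{i ∈ I b} m_{US}(k,i)/(|U||S|)` and the hub
masses `h a b = Σ_v μ(v) X_a(v) Y_b(v)` (`μ(v) = P_U(u k = v)`, `X_a(v) = P_T(t⁻¹ v ∈ J a)`,
`Y_b(v) = P_S(s⁻¹ v ∈ I b)`) satisfy `h ≥ 0`, `Σ_b h a b ≤ σ' a`, `Σ_a h a b ≤ ρ' b` and the
budget `Σ_P σ' + Σ_Q ρ' ≤ 1 + Σ_P Σ_Q h`. [folklore] -/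
theorem hub_budget_facts {n m : ℕ} {S T U : Finset (Equiv.Perm (Fin n))} (hS0 : S.Nonempty)
    (hT0 : T.Nonempty) (hU0 : U.Nonempty) (k : Fin n) (J I : Fin m → Finset (Fin n))
    (hJ : ∀ a a', a ≠ a' → Disjoint (J a) (J a')) (hI : ∀ b b', b ≠ b' → Disjoint (I b) (I b'))
    (σ' ρ' : Fin m → ℝ) (h : Fin m → Fin m → ℝ)
    (hσ' : ∀ a, σ' a = ∑ j ∈ J a,
      (((T ×ˢ U).filter fun tu => tu.2 k = tu.1 j).card : ℝ) / (T.card * U.card : ℕ))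
    (hρ' : ∀ b, ρ' b = ∑ i ∈ I b,
      (((U ×ˢ S).filter fun us => us.2 i = us.1 k).card : ℝ) / (U.card * S.card : ℕ))
    (hh : ∀ a b, h a b = ∑ v : Fin n, ((U.filter fun u => u k = v).card : ℝ) / U.card *
      ((((T.filter fun t => t⁻¹ v ∈ J a).card : ℝ) / T.card) *
        (((S.filter fun s => s⁻¹ v ∈ I b).card : ℝ) / S.card))) :
    (∀ a b, 0 ≤ h a b) ∧ (∀ a, ∑ b, h a b ≤ σ' a) ∧ (∀ b, ∑ a, h a b ≤ ρ' b) ∧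
      ∀ P Q : Finset (Fin m), ∑ a ∈ P, σ' a + ∑ b ∈ Q, ρ' b ≤ 1 + ∑ a ∈ P, ∑ b ∈ Q, h a b :=
  hub_budget_core (fun v => ((U.filter fun u => u k = v).card : ℝ) / U.card)
    (fun a v => ((T.filter fun t => t⁻¹ v ∈ J a).card : ℝ) / T.card)
    (fun b v => ((S.filter fun s => s⁻¹ v ∈ I b).card : ℝ) / S.card) σ' ρ' h
    (fun v => by positivity) (sum_fibre_prob_eq_one U hU0 k) (fun a v => by positivity)
    (fun b v => by positivity) (sum_pullback_le_one T hT0 J hJ) (sum_pullback_le_one S hS0 I hI)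
    (fun a => by rw [hσ' a]; exact blockMass_eq_sum_mu T U hT0 hU0 (J a) k)
    (fun b => by rw [hρ' b]; exact blockMassRow_eq_sum_mu U S (I b) k) hh

/-! ## The stub -/

/-- **Atom basic facts (HA0).** At a fixed position `k`, with level blocks `J_a` of the heavy
column `dB(·,k)` and `I_b` of the heavy row `dC(k,·)` (thresholds `θB, θC ≥ 16/n`), kept block
masses `σ, ρ`, block masses `σ', ρ'`, hub masses `h` and kept atom masses `Ψ`:
(1)-(2) `0 ≤ σ ≤ σ'`, `15/16 σ' ≤ σ` (same for `ρ`); (3) `h ≥ 0`; (4)-(5) the row/column sums of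
`h` are at most the block masses; (6) the budget `Σ_P σ' + Σ_Q ρ' ≤ 1 + Σ_{P × Q} h`;
(7) `Ψ ≥ 0`; (8)-(10) the kept sums `Σ_j pB`, `Σ_i pC`, `Σ_i Σ_j dA pB pC` split over the
levels / atoms. [folklore] -/
theorem atom_basic_facts {n : ℕ} (hn : 2 ≤ n) {S T U : Finset (Equiv.Perm (Fin n))} (hS0 : S.Nonempty) (hT0 : T.Nonempty) (hU0 : U.Nonempty) (dA dB dC pB pC : Fin n → Fin n → ℝ) (hdA : ∀ i j, dA i j = (((S ×ˢ T).filter fun st => st.2 j = st.1 i).card : ℝ) / (S.card * T.card : ℕ)) (hdB : ∀ j k, dB j k = (((T ×ˢ U).filter fun tu => tu.2 k = tu.1 j).card : ℝ) / (T.card * U.card : ℕ)) (hdC : ∀ k i, dC k i = (((U ×ˢ S).filter fun us => us.2 i = us.1 k).card : ℝ) / (U.card * S.card : ℕ)) (θB θC : ℝ) (hθB : 16 / (n : ℝ) ≤ θB) (hθC : 16 / (n : ℝ) ≤ θC) (hpB : ∀ j k, pB j k = if θB ≤ dB j k then dB j k - 1 / n else 0) (hpC : ∀ k i, pC k i = if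 θC ≤ dC k i then dC k i - 1 / n else 0) (k : Fin n) (σ σ' ρ ρ' : Fin (⌊Real.logb 2 ((n : ℝ) ^ 2)⌋₊ + 1) → ℝ) (hσ : ∀ a, σ a = ∑ j ∈ Finset.univ.filter (fun j => θB ≤ dB j k ∧ ⌊Real.logb 2 (1 / dB j k)⌋₊ = a.val), pB j k) (hσ' : ∀ a, σ' a = ∑ j ∈ Finset.univ.filter (fun j => θB ≤ dB j k ∧ ⌊Real.logb 2 (1 / dB j k)⌋₊ = a.val), dB j k) (hρ : ∀ b, ρ b = ∑ i ∈ Finset.univ.filter (fun i => θC ≤ dC k i ∧ ⌊Real.logb 2 (1 / dC k i)⌋₊ = b.val), pC k i) (hρ' : ∀ b, ρ' b = ∑ i ∈ Finset.univ.filter (fun i => θC ≤ dC k i ∧ ⌊Real.logb 2 (1 / dC k i)⌋₊ = b.val), dC k i) (h Ψ : Fin (⌊Real.logb 2 ((n : ℝ) ^ 2)⌋₊ + 1) → Fin (⌊Real.logb 2 ((n : ℝ) ^ 2)⌋₊ + 1) → ℝ) (hh : ∀ a b, h a b = ∑ v : Fin n, ((U.filter fun u => u k = v).card : ℝ) / U.card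 * ((((T.filter fun t => t⁻¹ v ∈ Finset.univ.filter (fun j => θB ≤ dB j k ∧ ⌊Real.logb 2 (1 / dB j k)⌋₊ = a.val)).card : ℝ) / T.card) * (((S.filter fun s => s⁻¹ v ∈ Finset.univ.filter (fun i => θC ≤ dC k i ∧ ⌊Real.logb 2 (1 / dC k i)⌋₊ = b.val)).card : ℝ) / S.card))) (hΨ : ∀ a b, Ψ a b = ∑ i ∈ Finset.univ.filter (fun i => θC ≤ dC k i ∧ ⌊Real.logb 2 (1 / dC k i)⌋₊ = b.val), ∑ j ∈ Finset.univ.filter (fun j => θB ≤ dB j k ∧ ⌊Real.logb 2 (1 / dB j k)⌋₊ = a.val), dA i j * pB j k * pC k i) : (∀ a, 0 ≤ σ a ∧ σ a ≤ σ' a ∧ 15 / 16 * σ' a ≤ σ a) ∧ (∀ b, 0 ≤ ρ b ∧ ρ b ≤ ρ' b ∧ 15 / 16 * ρ' b ≤ ρ b) ∧ (∀ a b, 0 ≤ h a b) ∧ (∀ a, ∑ b, h a b ≤ σ' a) ∧ (∀ b, ∑ a, h a b ≤ ρ' b) ∧ (∀ (P Q : Finset (Fin (⌊Real.logb 2 ((n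 : ℝ) ^ 2)⌋₊ + 1))), ∑ a ∈ P, σ' a + ∑ b ∈ Q, ρ' b ≤ 1 + ∑ a ∈ P, ∑ b ∈ Q, h a b) ∧ (∀ a b, 0 ≤ Ψ a b) ∧ (∑ j : Fin n, pB j k = ∑ a, σ a) ∧ (∑ i : Fin n, pC k i = ∑ b, ρ b) ∧ (∑ i : Fin n, ∑ j : Fin n, dA i j * pB j k * pC k i = ∑ a, ∑ b, Ψ a b) := by
  have hn0 : 0 < n := by omega
  have hn1 : 1 ≤ n := by omega
  have hdB1 : ∀ j, dB j k ≤ 1 := fun j => by rw [hdB]; exact pairDensity_le_one T U _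
  have hdC1 : ∀ i, dC k i ≤ 1 := fun i => by rw [hdC]; exact pairDensity_le_one U S _
  have hpB0 : ∀ j, ¬θB ≤ dB j k → pB j k = 0 := fun j hj => by rw [hpB, if_neg hj]
  have hpC0 : ∀ i, ¬θC ≤ dC k i → pC k i = 0 := fun i hi => by rw [hpC, if_neg hi]
  -- conjuncts (3)-(6): hub-mass bookkeeping
  obtain ⟨h3, h4, h5, h6⟩ := hub_budget_facts hS0 hT0 hU0 k
    (fun a => Finset.univ.filter (fun j => θB ≤ dB j k ∧ ⌊Real.logb 2 (1 / dB j k)⌋₊ = a.val))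
    (fun b => Finset.univ.filter (fun i => θC ≤ dC k i ∧ ⌊Real.logb 2 (1 / dC k i)⌋₊ = b.val))
    (fun a a' hne => Finset.disjoint_filter.2 fun j _ hj hj' =>
      hne (Fin.ext (hj.2.symm.trans hj'.2)))
    (fun b b' hne => Finset.disjoint_filter.2 fun i _ hi hi' =>
      hne (Fin.ext (hi.2.symm.trans hi'.2)))
    σ' ρ' h (fun a => by rw [hσ' a]; exact Finset.sum_congr rfl fun j _ => hdB j k)
    (fun b => by rw [hρ' b]; exact Finset.sum_congr rfl fun i _ => hdC k i) hh
  refine ⟨fun a => ?_, fun b => ?_, h3, h4, h5, h6, fun a b => ?_, ?_, ?_, ?_⟩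
  · -- (1)
    rw [hσ a, hσ' a]
    exact level_sums_cmp hn0 (fun j => dB j k) (fun j => pB j k) θB hθB (fun j => hpB j k) a.val
  · -- (2)
    rw [hρ b, hρ' b]
    exact level_sums_cmp hn0 (fun i => dC k i) (fun i => pC k i) θC hθC (fun i => hpC k i) b.val
  · -- (7)
    rw [hΨ]
    refine Finset.sum_nonneg fun i _ => Finset.sum_nonneg fun j _ => ?_
    have hA : 0 ≤ dA i j := by rw [hdA]; positivity
    exact mul_nonneg (mul_nonneg hA (kept_nonneg hn0 θB _ _ hθB (hpB j k)))
      (kept_nonneg hn0 θC _ _ hθC (hpC k i))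
  · -- (8)
    simp only [hσ]
    exact sum_eq_sum_levels_of_vanish hn1 (fun j => dB j k) θB hθB hdB1 (fun j => pB j k) hpB0
  · -- (9)
    simp only [hρ]
    exact sum_eq_sum_levels_of_vanish hn1 (fun i => dC k i) θC hθC hdC1 (fun i => pC k i) hpC0
  · -- (10)
    simp only [hΨ]
    exact double_sum_eq_sum_atoms hn1 (fun j => dB j k) (fun i => dC k i) θB θC hθB hθC hdB1 hdC1
      (fun i j => dA i j * pB j k * pC k i) (fun i j hj => by rw [hpB0 j hj, mul_zero, zero_mul])
      (fun i j hi => by rw [hpC0 i hi, mul_zero])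

end Summit.MatrixMultiplication.MatrixMultiplication.Theorems.PolynomialSlack
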